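import Literature.MathematicalPhysics.QuantumFieldTheory.Balaban1983to89.Beta.KernelWard
import Literature.MathematicalPhysics.QuantumFieldTheory.Balaban1983to89.Beta.RateCertificate
import Literature.MathematicalPhysics.QuantumFieldTheory.Balaban1983to89.Beta.OneStepKernelFamily

/-!
# `Balaban1983to89.Beta.HessKerRate` — the LIPSCHITZ (difference) calculus of the resolvent Hessian kernel `hessKer A V W`
# in its three arguments, and the consequence: GEOMETRICALLY CONVERGENT ingredients ⟹ `GeomRate` of the (1.22)-moments
# (road A2 / (SW1) of the β sub-cell, GENERIC half; asymptotic lane asym1, gen 7, v1; v1.1 = + §6 vertex Lipschitz;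
# v1.2 = docstring-only: the ABSOLUTE RULE paragraph restored to the charter's three sentences, declarations byte-identical)

HONEST FRAMING (cell contract, verbatim): «discharging `BetaPertH` makes Bałaban's UV stability UNCONDITIONAL — a real
constructive-QFT result; it is NOT the continuum limit and NOT the Clay problem.»  THIS MODULE is [folklore] analysis on `ℤ^D`
(multilinear telescoping of absolutely convergent lattice sums); it formalises NO statement printed in Bałaban's papers, cites
none as a hypothesis, mints no `Prop` fact, instantiates NO binder of the wall (RULING (R18-3)) and DISCHARGES NOTHING of it.
NOT summit progress.

ABSOLUTE RULE (cell, verbatim): «No internally-minted statement may enter as a cited fact. Every hypothesis is either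
kernel-proved in this package or a verbatim quotation of a PUBLISHED theorem with page reference. The manuscript(s) under
audit are NOT citable for their own disputed steps — they are the thing under adjudication; programme-internal
(2001/route/tribunal) claims are never citable.»  Every theorem below is kernel-proved from explicit, abstract hypotheses on
matrix-fibred kernels (`ExpKernelCalculus.Decays` / `BiLoc` / `VertexFamily` / `VertexFamily₂`); nothing asserts that any
kernel IS Bałaban's.  (v1.2: third sentence restored — same defect class as XREAD C-lit2g19-5 D1 (`HessKerSchur` v1.1) and
C-lit2g18-7 D1 (`HessianTelescopingKKT` v1.2); docstring-only, every declaration byte-identical to v1.1 p189430.)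

## Why (context only; asserted nowhere below)

The sub-cell lead's POST-EXIT-B MAP (BETA-SPEC.md §7.44 (g), WALL.md v2.9 §6) records two typed EXIT-A roads; ROAD A2 = rate +
certificate: `RateCertificate.GeomRate.drift` / `RemainderConstCertified.endpointExistence_of_marginConst`, whose ONE analytic input is
**(SW1)** `RateCertificate.GeomRate (fun j => secondMoment (T j) μ ν) b∞ c₀ θ` with EXPLICIT `(c₀, θ)` for the typed step kernels
`T j = OneStepKernelFamily.TbalOf Lc Js j = hessKer (A j) (V j) (W j)` (`OneStepKernelFamily.TstepOf` is LITERALLY of the form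
`hessKer A (vertexOfK A N S) W`).  AN2.md §6 splits (SW1) as (CONV-C) ⇒ (CONV-Π) ⇒ (CONV-β): «[elementary] … telescope
A₁⋯A₄ − A′₁⋯A′₄ = Σ_i A′₁⋯(A_i − A′_i)⋯A₄».  This file is that elementary implication, TYPED WITH CONSTANTS, for the resolvent
Hessian shape of `ExpKernelCalculus` §5:

* §1 the two explicit constants: `hessConst` (the (5.10)-constant of `hessKer A V W` as a FUNCTION of the decay data — the
  witness hidden in `ExpKernelCalculus.decay510_hessKer`'s `∃ C′`) and `lipConst` (the Lipschitz constant, LINEAR in the three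
  deviations `εA, εV, εW`: `lipConst_mul`), with `hessConst = lipConst` at zero reference (`lipConst_zero_ref`);
* §2 DIFFERENCE IDENTITIES for absolutely convergent compositions and traces (`comp_sub_comp`, `comp_sub_comp_bb`,
  `tadpole_sub_tadpole`, `bubble_sub_bubble`) and the resulting SMALLNESS of differences (`biLoc_comp_sub_comp`,
  `abs_tadpole_sub_le`, `abs_bubble_sub_le`) — constants of the exact shape of `ExpKernelCalculus.abs_tadpole_le` /
  `abs_bubble_le` with one factor replaced by a deviation;
* §3 **`decay510_hessKer_sub`**: `|hessKer A V W μ ν z − hessKer A′ V′ W′ μ ν z| ≤ lipConst(…, εA, εV, εW)·e^{−(δ/4)|z|₁}` whenever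
  `Decays (A − A′) εA δ`, `VertexFamily (V − V′) N εV δ`, `VertexFamily₂ (W − W′) N εW δ` (plus the individual bounds), blocking
  `N ≥ 1`; and the explicit-constant (5.10) bound `decay510_hessKer_explicit` (reference `0`);
* §4 **RATES**: for families `(A j, V j, W j)` with `j`-UNIFORM decay data converging GEOMETRICALLY (`θ^j`) to `(A∞, V∞, W∞)` in the
  same classes: `uniformDecay_hessKer` (= `LimitRate.UniformDecay`, constant `hessConst`), `geometricRate_hessKer`
  (= `LimitRate.GeometricRate`, constant `lipConst` at the rate constants), hence **`geomRate_secondMoment_hessKer`**: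
  `RateCertificate.GeomRate (fun j => secondMoment (hessKer (A j) (V j) (W j)) μ ν) (secondMoment (hessKer A∞ V∞ W∞) μ ν)
  (betaPrime510 D (lipConst …) (δ/4)) θ` — (SW1)'s SHAPE with `c₀` EXPLICIT — and the road-A2 socket by name
  (`oneLoopDrift_secondMoment_hessKer` = `RateCertificate.GeomRate.drift`);
* §5 UNITS INVARIANCE (`scaleK`, `hessKer_scaleK`): `hessKer (uAu) (u′Vu′) (u′Wu′) = hessKer A V W` for fibrewise constant
  rescalings with `u·u′ = 1` — the identity that lets a consumer pass from a step family whose raw constituents carry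
  `j`-dependent units (RULING (R25-1): `D_j(·)D_j`-dressings) to RESCALED constituents before asking for convergence;
  `decays_scaleK` / `biLoc_scaleK` transport the decay classes;
* §6 (v1.1) THE CHAIN-RULE VERTEX IS LIPSCHITZ IN `(K, S)`: `OneStepKernelFamily.vertexOfK K N S` (the first-order slot of
  `TstepOf`, built from the resolvent `K` and a local stencil table `S` through `OneStepResolventKernel.wsum`) satisfies
  `VertexFamily (vertexOfK K N S − vertexOfK K′ N S′) N ((d+1)·((εK·Cs + C′·εS)·Zl(δ/2))) (δ/2)` (`vertexFamily_vertexOfK_sub`;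
  telescoping `wsum_sub_wsum`), with the rate form `vertexFamily_vertexOfK_rate` (= §4's hypothesis `hVrate` from the convergence
  of the PRIMITIVES `K_j`, `S_j`) and `vertexFamily_vertexOfK_uniform` (= §4's `hV`).

RELATION TO `T4RateAlgebra` (pv25): `RatePair.mul` / `.conv` close uniform-decay + step-rate pairs for TRANSLATION-INVARIANT
SCALAR kernels `ℤ^d → ℝ` under pointwise product and `ℤ^d`-convolution; this file is the same telescoping for the TWO-POINT
MATRIX-FIBRED kernels `MKer D F` of `ExpKernelCalculus` (composition `Σ'_y Σ_f`, bi-localised vertex insertions, traces) in which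
`TstepOf` / `TbalOf` are typed, landing directly in `LimitRate.GeometricRate` / `RateCertificate.GeomRate` — no duplication.

WHAT IS NOT HERE (located, NOT in print, NOT claimed): the hypotheses of §4 for Bałaban's (rescaled) step constituents — the
`j`-uniform decay data are (α)-type inputs (printed `k`-uniform bounds, B4/B5/B9), the GEOMETRIC CONVERGENCE `Decays (A j − A∞)
(cA θ^j) δ` etc. is AN2.md §6 (CONV-C) (OPEN; O-an2-2 / O-asym1-1; the series prints `η`-uniform bounds only); the typed step jets
`JsBal` ((i′), an2); any identification with Bałaban's `β⁰`.  With those supplied, §4 is (SW1) verbatim and road A2 continues in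
`RateCertificate` (margin / eventual-positivity sockets) — NOT continuum, NOT Clay.
-/

open Finset Filter
open scoped BigOperators
open Literature.MathematicalPhysics.QuantumFieldTheory.Balaban1983to89
open Literature.MathematicalPhysics.QuantumFieldTheory.Balaban1983to89.Beta
open B12Sec2to5 (l1 l1_nonneg Decay510 betaPrime510)
open ExpKernelCalculus (MKer Decays BiLoc comp tr bubble tadpole VertexFamily VertexFamily₂ hessKer Zl Zl_nonneg
  biLoc_comp_decays biLoc_comp_biLoc summable_trTerm abs_tr_le l1_natSmul l1_sub_symm)
open KernelWard (Bdd bdd_of_decays bdd_of_biLoc biLoc_add slices_bdd_biLoc slices_biLoc_bdd comp_sub_left comp_sub_right tr_sub)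

namespace Literature.MathematicalPhysics.QuantumFieldTheory.Balaban1983to89.Beta.HessKerRate

noncomputable section

variable {D : ℕ} {F : Type*} [Fintype F]

/-! ## §1 The explicit constants -/

/-- THE EXPLICIT (5.10)-CONSTANT of `hessKer A V W` in terms of the decay data `(cF = |F|, δ, C, Cv, Cw)`:
`½·Kt + ½·Kb` with `Kt`, `Kb` the constants of `ExpKernelCalculus.abs_tadpole_le` / `abs_bubble_le`. [folklore] -/
def hessConst (D : ℕ) (cF δ C Cv Cw : ℝ) : ℝ :=
  1 / 2 * (cF * (cF * (C * Cw) * Zl D (δ - δ / 2)) * Zl D (δ / 2 / 2)) +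
    1 / 2 * (cF * (cF * ((cF * (C * Cv) * Zl D (δ - δ / 2)) * (cF * (C * Cv) * Zl D (δ - δ / 2))) * Zl D (δ / 2 / 2)) *
      Zl D (δ / 2 / 2))

/-- THE TADPOLE-CHANNEL LIPSCHITZ CONSTANT: `A` deviates by `εA` (reference constant `C′`), the second-order vertex by `εW`
(constant `Cw`). [folklore] -/
def lipT (D : ℕ) (cF δ C' Cw εA εW : ℝ) : ℝ :=
  cF * (cF * (εA * Cw) * Zl D (δ - δ / 2) + cF * (C' * εW) * Zl D (δ - δ / 2)) * Zl D (δ / 2 / 2)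

/-- THE BUBBLE-CHANNEL LIPSCHITZ CONSTANT: `A` deviates by `εA` (constants `C`, reference `C′`), the left vertex slot by `εV`
(constants `Cv`, reference `Cv′`), the right vertex slot by `εW` (constant `Cw`). [folklore] -/
def lipB (D : ℕ) (cF δ C C' Cv Cv' Cw εA εV εW : ℝ) : ℝ :=
  cF * (cF * ((cF * (εA * Cv) * Zl D (δ - δ / 2) + cF * (C' * εV) * Zl D (δ - δ / 2)) *
            (cF * (C * Cw) * Zl D (δ - δ / 2))) * Zl D (δ / 2 / 2) +
        cF * ((cF * (C' * Cv') * Zl D (δ - δ / 2)) *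
            (cF * (εA * Cw) * Zl D (δ - δ / 2) + cF * (C' * εW) * Zl D (δ - δ / 2))) * Zl D (δ / 2 / 2)) *
    Zl D (δ / 2 / 2)

/-- **THE LIPSCHITZ CONSTANT OF `hessKer`**: `½·lipT + ½·lipB` (the bubble of `hessKer` has the first-order family in BOTH slots).
Arguments: `cF = |F|`, rate `δ`, `Decays` constants `C` (of `A`) and `C′` (of the reference `A′`), vertex constants `Cv` / `Cv′`,
second-order constant `Cw`, deviations `εA, εV, εW`. [folklore] -/
def lipConst (D : ℕ) (cF δ C C' Cv Cv' Cw εA εV εW : ℝ) : ℝ :=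
  1 / 2 * lipT D cF δ C' Cw εA εW + 1 / 2 * lipB D cF δ C C' Cv Cv' Cv εA εV εV

/-- `0 ≤ lipT` for nonnegative data. [folklore] -/
theorem lipT_nonneg {cF δ C' Cw εA εW : ℝ} (hcF : 0 ≤ cF) (hδ : 0 < δ) (hC' : 0 ≤ C') (hCw : 0 ≤ Cw) (hεA : 0 ≤ εA)
    (hεW : 0 ≤ εW) : 0 ≤ lipT D cF δ C' Cw εA εW := by
  have hZ1 : 0 ≤ Zl D (δ - δ / 2) := Zl_nonneg (by linarith)
  have hZ2 : 0 ≤ Zl D (δ / 2 / 2) := Zl_nonneg (by linarith)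
  unfold lipT; positivity

/-- `0 ≤ lipB` for nonnegative data. [folklore] -/
theorem lipB_nonneg {cF δ C C' Cv Cv' Cw εA εV εW : ℝ} (hcF : 0 ≤ cF) (hδ : 0 < δ) (hC : 0 ≤ C) (hC' : 0 ≤ C') (hCv : 0 ≤ Cv)
    (hCv' : 0 ≤ Cv') (hCw : 0 ≤ Cw) (hεA : 0 ≤ εA) (hεV : 0 ≤ εV) (hεW : 0 ≤ εW) :
    0 ≤ lipB D cF δ C C' Cv Cv' Cw εA εV εW := by
  have hZ1 : 0 ≤ Zl D (δ - δ / 2) := Zl_nonneg (by linarith)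
  have hZ2 : 0 ≤ Zl D (δ / 2 / 2) := Zl_nonneg (by linarith)
  unfold lipB; positivity

/-- `0 ≤ lipConst` for nonnegative data. [folklore] -/
theorem lipConst_nonneg {cF δ C C' Cv Cv' Cw εA εV εW : ℝ} (hcF : 0 ≤ cF) (hδ : 0 < δ) (hC : 0 ≤ C) (hC' : 0 ≤ C')
    (hCv : 0 ≤ Cv) (hCv' : 0 ≤ Cv') (hCw : 0 ≤ Cw) (hεA : 0 ≤ εA) (hεV : 0 ≤ εV) (hεW : 0 ≤ εW) :
    0 ≤ lipConst D cF δ C C' Cv Cv' Cw εA εV εW := by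
  have h1 := lipT_nonneg (D := D) hcF hδ hC' hCw hεA hεW
  have h2 := lipB_nonneg (D := D) hcF hδ hC hC' hCv hCv' hCv hεA hεV hεV
  unfold lipConst; positivity

/-- `0 ≤ hessConst` for nonnegative data. [folklore] -/
theorem hessConst_nonneg {cF δ C Cv Cw : ℝ} (hcF : 0 ≤ cF) (hδ : 0 < δ) (hC : 0 ≤ C) (hCv : 0 ≤ Cv) (hCw : 0 ≤ Cw) :
    0 ≤ hessConst D cF δ C Cv Cw := by
  have hZ1 : 0 ≤ Zl D (δ - δ / 2) := Zl_nonneg (by linarith)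
  have hZ2 : 0 ≤ Zl D (δ / 2 / 2) := Zl_nonneg (by linarith)
  unfold hessConst; positivity

/-- **LINEARITY OF THE LIPSCHITZ CONSTANT IN THE DEVIATIONS**: scaling all three deviations by `t` scales `lipConst` by `t` — the
step from «differences `≤ c·θ^j`» to «`hessKer`-differences `≤ (lipConst at c)·θ^j`». [folklore] -/
theorem lipConst_mul (cF δ C C' Cv Cv' Cw εA εV εW t : ℝ) :
    lipConst D cF δ C C' Cv Cv' Cw (εA * t) (εV * t) (εW * t) = lipConst D cF δ C C' Cv Cv' Cw εA εV εW * t := by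
  unfold lipConst lipT lipB; ring

/-- At ZERO REFERENCE (`A′ = 0`, `V′ = 0`, `W′ = 0`: `C′ = Cv′ = 0`, deviations = the constants themselves) the Lipschitz
constant is the (5.10)-constant. [folklore] -/
theorem lipConst_zero_ref (cF δ C Cv Cw : ℝ) : lipConst D cF δ C 0 Cv 0 Cw C Cv Cw = hessConst D cF δ C Cv Cw := by
  unfold lipConst lipT lipB hessConst; ring

/-- `lipConst` is monotone in the three deviations (nonnegative data). [folklore] -/
theorem lipConst_mono {cF δ C C' Cv Cv' Cw εA εV εW εA' εV' εW' : ℝ} (hcF : 0 ≤ cF) (hδ : 0 < δ) (hC : 0 ≤ C)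
    (hC' : 0 ≤ C') (hCv : 0 ≤ Cv) (hCv' : 0 ≤ Cv') (hCw : 0 ≤ Cw) (hA : εA ≤ εA') (hV : εV ≤ εV') (hW : εW ≤ εW') :
    lipConst D cF δ C C' Cv Cv' Cw εA εV εW ≤ lipConst D cF δ C C' Cv Cv' Cw εA' εV' εW' := by
  have hZ1 : 0 ≤ Zl D (δ - δ / 2) := Zl_nonneg (by linarith)
  have hZ2 : 0 ≤ Zl D (δ / 2 / 2) := Zl_nonneg (by linarith)
  unfold lipConst lipT lipB
  gcongr

/-! ## §2 Difference identities and the smallness of differences -/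

omit [Fintype F] in
/-- The zero kernel decays with constant `0`. [folklore] -/
theorem decays_zero (δ : ℝ) : Decays (0 : MKer D F) 0 δ := by
  intro x y a b; simp

omit [Fintype F] in
/-- The zero kernel is bi-localised with constant `0`. [folklore] -/
theorem biLoc_zero (p q : (Fin D → ℤ)) (δ : ℝ) : BiLoc (0 : MKer D F) p q 0 δ := by
  intro x y a b; simp

omit [Fintype F] in
/-- Difference of two decaying kernels (crude constant; the SMALL constant is a hypothesis where it matters). [folklore] -/
theorem decays_sub {A A' : MKer D F} {C C' δ : ℝ} (h : Decays A C δ) (h' : Decays A' C' δ) : Decays (A - A') (C + C') δ := by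
  intro x y a b
  simp only [Pi.sub_apply]
  calc |A x y a b - A' x y a b| ≤ |A x y a b| + |A' x y a b| := abs_sub _ _
    _ ≤ _ := by rw [add_mul]; exact add_le_add (h x y a b) (h' x y a b)

/-- **TELESCOPING, decaying ∘ bi-localised**: `A∘K − A′∘K′ = (A − A′)∘K + A′∘(K − K′)` (all four series absolutely convergent).
[folklore] -/
theorem comp_sub_comp {A A' K K' : MKer D F} {C C' Ck Ck' δ : ℝ} {p q : (Fin D → ℤ)} (hA : Decays A C δ) (hA' : Decays A' C' δ)
    (hK : BiLoc K p q Ck δ) (hK' : BiLoc K' p q Ck' δ) (hδ : 0 < δ) :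
    comp A K - comp A' K' = comp (A - A') K + comp A' (K - K') := by
  have hAb := bdd_of_decays hA hδ.le
  have hAb' := bdd_of_decays hA' hδ.le
  rw [comp_sub_left (slices_bdd_biLoc hAb hK hδ) (slices_bdd_biLoc hAb' hK hδ),
    comp_sub_right (slices_bdd_biLoc hAb' hK hδ) (slices_bdd_biLoc hAb' hK' hδ)]
  exact (sub_add_sub_cancel _ _ _).symm

/-- **SMALLNESS, decaying ∘ bi-localised**: if moreover `Decays (A − A′) εA δ` and `BiLoc (K − K′) p q εK δ`, then `A∘K − A′∘K′` is
bi-localised at `(p, q)`, rate `δ/2`, constant `|F|·(εA·Ck + C′·εK)·Zl(δ/2)` (written as a sum). [folklore] -/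
theorem biLoc_comp_sub_comp {A A' K K' : MKer D F} {C C' Ck Ck' εA εK δ : ℝ} {p q : (Fin D → ℤ)} (hA : Decays A C δ)
    (hA' : Decays A' C' δ) (hAA : Decays (A - A') εA δ) (hK : BiLoc K p q Ck δ) (hK' : BiLoc K' p q Ck' δ)
    (hKK : BiLoc (K - K') p q εK δ) (hδ : 0 < δ) :
    BiLoc (comp A K - comp A' K') p q
      ((Fintype.card F : ℝ) * (εA * Ck) * Zl D (δ - δ / 2) + (Fintype.card F : ℝ) * (C' * εK) * Zl D (δ - δ / 2)) (δ / 2) := by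
  rw [comp_sub_comp hA hA' hK hK' hδ]
  exact biLoc_add (biLoc_comp_decays hAA hK (by linarith) (by linarith)) (biLoc_comp_decays hA' hKK (by linarith) (by linarith))

/-- **TELESCOPING, bi-localised ∘ bi-localised**: `K∘L − K′∘L′ = (K − K′)∘L + K′∘(L − L′)`. [folklore] -/
theorem comp_sub_comp_bb {K K' L L' : MKer D F} {Ck Ck' Cl Cl' δ : ℝ} {p p' q' q : (Fin D → ℤ)} (hK : BiLoc K p p' Ck δ)
    (hK' : BiLoc K' p p' Ck' δ) (hL : BiLoc L q' q Cl δ) (hL' : BiLoc L' q' q Cl' δ) (hδ : 0 < δ) :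
    comp K L - comp K' L' = comp (K - K') L + comp K' (L - L') := by
  have hLb := bdd_of_biLoc hL hδ.le
  have hLb' := bdd_of_biLoc hL' hδ.le
  rw [comp_sub_left (slices_biLoc_bdd hK hLb hδ) (slices_biLoc_bdd hK' hLb hδ),
    comp_sub_right (slices_biLoc_bdd hK' hLb hδ) (slices_biLoc_bdd hK' hLb' hδ)]
  exact (sub_add_sub_cancel _ _ _).symm

/-- **SMALLNESS, bi-localised ∘ bi-localised** (`K, K′` at `(p, p′)`, `L, L′` at `(q′, q)`, deviations `εK, εL`): `K∘L − K′∘L′` is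
bi-localised at `(p, q)` with constant `|F|·(εK·Cl + Ck′·εL)·Zl(δ/2)·e^{−(δ/2)|p′−q′|₁}` (written as a sum). [folklore] -/
theorem biLoc_comp_sub_comp_bb {K K' L L' : MKer D F} {Ck Ck' Cl Cl' εK εL δ : ℝ} {p p' q' q : (Fin D → ℤ)} (hK : BiLoc K p p' Ck δ)
    (hK' : BiLoc K' p p' Ck' δ) (hKK : BiLoc (K - K') p p' εK δ) (hL : BiLoc L q' q Cl δ) (hL' : BiLoc L' q' q Cl' δ)
    (hLL : BiLoc (L - L') q' q εL δ) (hδ : 0 < δ) :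
    BiLoc (comp K L - comp K' L') p q
      ((Fintype.card F : ℝ) * (εK * Cl) * Zl D (δ / 2) * Real.exp (-(δ / 2) * l1 (p' - q')) +
        (Fintype.card F : ℝ) * (Ck' * εL) * Zl D (δ / 2) * Real.exp (-(δ / 2) * l1 (p' - q'))) δ := by
  rw [comp_sub_comp_bb hK hK' hL hL' hδ]
  exact biLoc_add (biLoc_comp_biLoc hKK hL hδ) (biLoc_comp_biLoc hK' hLL hδ)

/-- `tadpole A K − tadpole A′ K′ = tr (A∘K − A′∘K′)` (both traces absolutely convergent). [folklore] -/
theorem tadpole_sub_tadpole {A A' K K' : MKer D F} {C C' Ck Ck' δ : ℝ} {p q : (Fin D → ℤ)} (hA : Decays A C δ)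
    (hA' : Decays A' C' δ) (hK : BiLoc K p q Ck δ) (hK' : BiLoc K' p q Ck' δ) (hδ : 0 < δ) :
    tadpole A K - tadpole A' K' = tr (comp A K - comp A' K') := by
  unfold ExpKernelCalculus.tadpole
  have hδ2 : 0 < δ / 2 := by linarith
  rw [tr_sub (summable_trTerm (biLoc_comp_decays hA hK hδ2.le (by linarith)) hδ2)
    (summable_trTerm (biLoc_comp_decays hA' hK' hδ2.le (by linarith)) hδ2)]

/-- **TADPOLE DIFFERENCE BOUND**: `|tadpole A K − tadpole A′ K′| ≤ lipT(|F|, δ, C′, Ck, εA, εK)·e^{−(δ/4)|p−q|₁}`. [folklore] -/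
theorem abs_tadpole_sub_le {A A' K K' : MKer D F} {C C' Ck Ck' εA εK δ : ℝ} {p q : (Fin D → ℤ)} (hA : Decays A C δ)
    (hA' : Decays A' C' δ) (hAA : Decays (A - A') εA δ) (hK : BiLoc K p q Ck δ) (hK' : BiLoc K' p q Ck' δ)
    (hKK : BiLoc (K - K') p q εK δ) (hδ : 0 < δ) :
    |tadpole A K - tadpole A' K'| ≤ lipT D (Fintype.card F) δ C' Ck εA εK * Real.exp (-(δ / 2 / 2) * l1 (p - q)) := by
  rw [tadpole_sub_tadpole hA hA' hK hK' hδ]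
  have h := abs_tr_le (biLoc_comp_sub_comp hA hA' hAA hK hK' hKK hδ) (by linarith : 0 < δ / 2)
  unfold lipT
  exact h

/-- `bubble A V W − bubble A′ V′ W′ = tr ((A∘V)∘(A∘W) − (A′∘V′)∘(A′∘W′))`. [folklore] -/
theorem bubble_sub_bubble {A A' V V' W W' : MKer D F} {C C' Cv Cv' Cw Cw' δ : ℝ} {p q : (Fin D → ℤ)} (hA : Decays A C δ)
    (hA' : Decays A' C' δ) (hV : BiLoc V p p Cv δ) (hV' : BiLoc V' p p Cv' δ) (hW : BiLoc W q q Cw δ)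
    (hW' : BiLoc W' q q Cw' δ) (hδ : 0 < δ) :
    bubble A V W - bubble A' V' W' = tr (comp (comp A V) (comp A W) - comp (comp A' V') (comp A' W')) := by
  unfold ExpKernelCalculus.bubble
  have hδ2 : 0 < δ / 2 := by linarith
  have hX := biLoc_comp_decays hA hV hδ2.le (by linarith)
  have hX' := biLoc_comp_decays hA' hV' hδ2.le (by linarith)
  have hY := biLoc_comp_decays hA hW hδ2.le (by linarith)
  have hY' := biLoc_comp_decays hA' hW' hδ2.le (by linarith)
  rw [tr_sub (summable_trTerm (biLoc_comp_biLoc hX hY hδ2) hδ2) (summable_trTerm (biLoc_comp_biLoc hX' hY' hδ2) hδ2)]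

/-- **BUBBLE DIFFERENCE BOUND**: `|bubble A V W − bubble A′ V′ W′| ≤ lipB(…)·E·E`, `E = e^{−(δ/4)|p−q|₁}`, the vertex slots
localised at `(p,p)` and `(q,q)` with deviations `εV`, `εW`. [folklore] -/
theorem abs_bubble_sub_le {A A' V V' W W' : MKer D F} {C C' Cv Cv' Cw Cw' εA εV εW δ : ℝ} {p q : (Fin D → ℤ)}
    (hA : Decays A C δ) (hA' : Decays A' C' δ) (hAA : Decays (A - A') εA δ) (hV : BiLoc V p p Cv δ)
    (hV' : BiLoc V' p p Cv' δ) (hVV : BiLoc (V - V') p p εV δ) (hW : BiLoc W q q Cw δ) (hW' : BiLoc W' q q Cw' δ)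
    (hWW : BiLoc (W - W') q q εW δ) (hδ : 0 < δ) :
    |bubble A V W - bubble A' V' W'| ≤
      lipB D (Fintype.card F) δ C C' Cv Cv' Cw εA εV εW * (Real.exp (-(δ / 2 / 2) * l1 (p - q)) *
        Real.exp (-(δ / 2 / 2) * l1 (p - q))) := by
  rw [bubble_sub_bubble hA hA' hV hV' hW hW' hδ]
  have hδ2 : 0 < δ / 2 := by linarith
  have hX := biLoc_comp_decays hA hV hδ2.le (by linarith)
  have hX' := biLoc_comp_decays hA' hV' hδ2.le (by linarith)
  have hXX := biLoc_comp_sub_comp hA hA' hAA hV hV' hVV hδ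
  have hY := biLoc_comp_decays hA hW hδ2.le (by linarith)
  have hY' := biLoc_comp_decays hA' hW' hδ2.le (by linarith)
  have hYY := biLoc_comp_sub_comp hA hA' hAA hW hW' hWW hδ
  have h := abs_tr_le (biLoc_comp_sub_comp_bb hX hX' hXX hY hY' hYY hδ2) hδ2
  refine h.trans (le_of_eq ?_)
  unfold lipB
  ring

/-! ## §3 The Lipschitz estimate for the resolvent Hessian kernel -/

/-- **THE LIPSCHITZ ESTIMATE**: for decaying `A, A′` (constants `C, C′`, difference `εA`), first-order vertex families `V, V′`
(constants `Cv, Cv′`, difference family constant `εV`) and second-order families `W, W′` (constants `Cw, Cw′`, difference `εW`),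
all at rate `δ > 0` and blocking `N ≥ 1`:
`|hessKer A V W μ ν z − hessKer A′ V′ W′ μ ν z| ≤ lipConst(|F|, δ, C, C′, Cv, Cv′, Cw, εA, εV, εW) · e^{−(δ/4)|z|₁}`. [folklore] -/
theorem decay510_hessKer_sub {A A' : MKer D F} {V V' : Fin D → (Fin D → ℤ) → MKer D F}
    {W W' : Fin D → (Fin D → ℤ) → Fin D → (Fin D → ℤ) → MKer D F} {C C' Cv Cv' Cw Cw' εA εV εW δ : ℝ} {N : ℕ}
    (hA : Decays A C δ) (hA' : Decays A' C' δ) (hAA : Decays (A - A') εA δ)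
    (hV : VertexFamily V N Cv δ) (hV' : VertexFamily V' N Cv' δ) (hVV : VertexFamily (V - V') N εV δ)
    (hW : VertexFamily₂ W N Cw δ) (hW' : VertexFamily₂ W' N Cw' δ) (hWW : VertexFamily₂ (W - W') N εW δ)
    (hδ : 0 < δ) (hN : 1 ≤ N) (μ ν : Fin D) :
    Decay510 (fun z => hessKer A V W μ ν z - hessKer A' V' W' μ ν z)
      (lipConst D (Fintype.card F) δ C C' Cv Cv' Cw εA εV εW) (δ / 4) := by
  classical
  intro z
  rcases isEmpty_or_nonempty F with hF | ⟨⟨a⟩⟩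
  · -- empty fibre: both kernels vanish and the constant is `0`
    have h0 : ∀ (A₀ : MKer D F) (V₀ : Fin D → (Fin D → ℤ) → MKer D F) (W₀ : Fin D → (Fin D → ℤ) → Fin D → (Fin D → ℤ) → MKer D F),
        hessKer A₀ V₀ W₀ μ ν z = 0 := fun A₀ V₀ W₀ => by
      simp [hessKer, ExpKernelCalculus.tadpole, ExpKernelCalculus.bubble, ExpKernelCalculus.tr, Finset.univ_eq_empty]
    have hc : (Fintype.card F : ℝ) = 0 := by simp [Fintype.card_eq_zero]
    simp only [h0, sub_self, abs_zero, hc, lipConst, lipT, lipB]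
    ring_nf
    rfl
  -- constants and their signs
  have hC' := hA'.nonneg a
  have hCv := (hV μ 0).nonneg a
  have hCv' := (hV' μ 0).nonneg a
  have hCw := (hW μ 0 ν 0).nonneg a
  have hC := hA.nonneg a
  have hεA := hAA.nonneg a
  have hεV := (hVV μ 0).nonneg a
  have hεW := (hWW μ 0 ν 0).nonneg a
  have hcF : 0 ≤ (Fintype.card F : ℝ) := Nat.cast_nonneg _
  have hKt := lipT_nonneg (D := D) hcF hδ hC' hCw hεA hεW
  have hKb := lipB_nonneg (D := D) hcF hδ hC hC' hCv hCv' hCv hεA hεV hεV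
  -- the two channel bounds at the localisation points `N•0`, `N•z`
  have ht : |tadpole A (W μ 0 ν z) - tadpole A' (W' μ 0 ν z)| ≤
      lipT D (Fintype.card F) δ C' Cw εA εW * Real.exp (-(δ / 2 / 2) * l1 (((N : ℤ) • (0 : (Fin D → ℤ))) - (N : ℤ) • z)) :=
    abs_tadpole_sub_le hA hA' hAA (hW μ 0 ν z) (hW' μ 0 ν z) (hWW μ 0 ν z) hδ
  have hb : |bubble A (V μ 0) (V ν z) - bubble A' (V' μ 0) (V' ν z)| ≤
      lipB D (Fintype.card F) δ C C' Cv Cv' Cv εA εV εV *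
        (Real.exp (-(δ / 2 / 2) * l1 (((N : ℤ) • (0 : (Fin D → ℤ))) - (N : ℤ) • z)) *
          Real.exp (-(δ / 2 / 2) * l1 (((N : ℤ) • (0 : (Fin D → ℤ))) - (N : ℤ) • z))) :=
    abs_bubble_sub_le hA hA' hAA (hV μ 0) (hV' μ 0) (hVV μ 0) (hV ν z) (hV' ν z) (hVV ν z) hδ
  -- the distance of the localisation points: |N•0 − N•z|₁ = N |z|₁ ≥ |z|₁
  have hdist : l1 (((N : ℤ) • (0 : (Fin D → ℤ))) - (N : ℤ) • z) = (N : ℝ) * l1 z := by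
    rw [smul_zero, zero_sub, ← smul_neg, l1_natSmul]
    congr 1
    simpa using l1_sub_symm (0 : (Fin D → ℤ)) z
  have hz := l1_nonneg z
  have hN' : (1 : ℝ) ≤ N := by exact_mod_cast hN
  set E := Real.exp (-(δ / 2 / 2) * l1 (((N : ℤ) • (0 : (Fin D → ℤ))) - (N : ℤ) • z)) with hEdef
  set E' := Real.exp (-(δ / 4) * l1 z) with hE'def
  have hE : 0 ≤ E := (Real.exp_pos _).le
  have hmul : l1 z ≤ (N : ℝ) * l1 z := le_mul_of_one_le_left hz hN'
  have hEE' : E ≤ E' := by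
    rw [hEdef, hE'def, hdist, Real.exp_le_exp]; nlinarith
  have hE1 : E ≤ 1 := by
    rw [hEdef, Real.exp_le_one_iff, hdist]; nlinarith
  have ht' : |tadpole A (W μ 0 ν z) - tadpole A' (W' μ 0 ν z)| ≤ lipT D (Fintype.card F) δ C' Cw εA εW * E' :=
    ht.trans (mul_le_mul_of_nonneg_left hEE' hKt)
  have hb' : |bubble A (V μ 0) (V ν z) - bubble A' (V' μ 0) (V' ν z)| ≤
      lipB D (Fintype.card F) δ C C' Cv Cv' Cv εA εV εV * E' := by
    refine hb.trans (mul_le_mul_of_nonneg_left ?_ hKb)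
    calc E * E ≤ E * 1 := mul_le_mul_of_nonneg_left hE1 hE
      _ ≤ E' := by rw [mul_one]; exact hEE'
  have hrw : hessKer A V W μ ν z - hessKer A' V' W' μ ν z =
      1 / 2 * (tadpole A (W μ 0 ν z) - tadpole A' (W' μ 0 ν z)) -
        1 / 2 * (bubble A (V μ 0) (V ν z) - bubble A' (V' μ 0) (V' ν z)) := by
    simp only [hessKer]; ring
  show |hessKer A V W μ ν z - hessKer A' V' W' μ ν z| ≤ _
  rw [hrw]
  calc |1 / 2 * (tadpole A (W μ 0 ν z) - tadpole A' (W' μ 0 ν z)) -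
          1 / 2 * (bubble A (V μ 0) (V ν z) - bubble A' (V' μ 0) (V' ν z))|
      ≤ |1 / 2 * (tadpole A (W μ 0 ν z) - tadpole A' (W' μ 0 ν z))| +
          |1 / 2 * (bubble A (V μ 0) (V ν z) - bubble A' (V' μ 0) (V' ν z))| := abs_sub _ _
    _ = 1 / 2 * |tadpole A (W μ 0 ν z) - tadpole A' (W' μ 0 ν z)| +
          1 / 2 * |bubble A (V μ 0) (V ν z) - bubble A' (V' μ 0) (V' ν z)| := by
        rw [abs_mul, abs_mul, abs_of_pos (by norm_num : (0 : ℝ) < 1 / 2)]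
    _ ≤ 1 / 2 * (lipT D (Fintype.card F) δ C' Cw εA εW * E') +
          1 / 2 * (lipB D (Fintype.card F) δ C C' Cv Cv' Cv εA εV εV * E') := by gcongr
    _ = lipConst D (Fintype.card F) δ C C' Cv Cv' Cw εA εV εW * E' := by unfold lipConst; ring

/-- The resolvent Hessian kernel of zero data vanishes. [folklore] -/
theorem hessKer_zero (μ ν : Fin D) (z : (Fin D → ℤ)) :
    hessKer (0 : MKer D F) (0 : Fin D → (Fin D → ℤ) → MKer D F) (0 : Fin D → (Fin D → ℤ) → Fin D → (Fin D → ℤ) → MKer D F) μ ν z = 0 := by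
  simp [hessKer, ExpKernelCalculus.tadpole, ExpKernelCalculus.bubble, ExpKernelCalculus.tr, ExpKernelCalculus.comp]

/-- **(5.10)-SHAPE DECAY WITH THE EXPLICIT CONSTANT `hessConst`** (the witness of `ExpKernelCalculus.decay510_hessKer`'s `∃ C′`,
as a function of the decay data only — hence UNIFORM along any family with uniform data). [folklore] -/
theorem decay510_hessKer_explicit {A : MKer D F} {V : Fin D → (Fin D → ℤ) → MKer D F}
    {W : Fin D → (Fin D → ℤ) → Fin D → (Fin D → ℤ) → MKer D F} {C Cv Cw δ : ℝ} {N : ℕ} (hA : Decays A C δ)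
    (hV : VertexFamily V N Cv δ) (hW : VertexFamily₂ W N Cw δ) (hδ : 0 < δ) (hN : 1 ≤ N) (μ ν : Fin D) :
    Decay510 (hessKer A V W μ ν) (hessConst D (Fintype.card F) δ C Cv Cw) (δ / 4) := by
  have hA0 : Decays (0 : MKer D F) 0 δ := decays_zero δ
  have hV0 : VertexFamily (0 : Fin D → (Fin D → ℤ) → MKer D F) N 0 δ := fun μ y => biLoc_zero _ _ δ
  have hW0 : VertexFamily₂ (0 : Fin D → (Fin D → ℤ) → Fin D → (Fin D → ℤ) → MKer D F) N 0 δ := fun μ y ν y' => biLoc_zero _ _ δ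
  have h := decay510_hessKer_sub hA hA0 (by simpa using hA) hV hV0 (by simpa using hV) hW hW0 (by simpa using hW) hδ hN μ ν
  rw [lipConst_zero_ref] at h
  intro z
  simpa [hessKer_zero] using h z

/-! ## §4 Rates: geometrically convergent ingredients ⟹ `GeomRate` of the second moments -/

section Rate

variable {A : ℕ → MKer D F} {Ainf : MKer D F} {V : ℕ → Fin D → (Fin D → ℤ) → MKer D F} {Vinf : Fin D → (Fin D → ℤ) → MKer D F}
  {W : ℕ → Fin D → (Fin D → ℤ) → Fin D → (Fin D → ℤ) → MKer D F} {Winf : Fin D → (Fin D → ℤ) → Fin D → (Fin D → ℤ) → MKer D F}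
  {C Cv Cw cA cV cW δ θ : ℝ} {N : ℕ}

/-- **(UD) FROM UNIFORM DATA**: `j`-uniform decay data ⟹ `LimitRate.UniformDecay` of the step kernels with constant `hessConst`.
[folklore] -/
theorem uniformDecay_hessKer (hA : ∀ j, Decays (A j) C δ) (hV : ∀ j, VertexFamily (V j) N Cv δ)
    (hW : ∀ j, VertexFamily₂ (W j) N Cw δ) (hδ : 0 < δ) (hN : 1 ≤ N) (μ ν : Fin D) :
    LimitRate.UniformDecay (fun j => hessKer (A j) (V j) (W j)) μ ν (hessConst D (Fintype.card F) δ C Cv Cw) (δ / 4) :=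
  fun j => decay510_hessKer_explicit (hA j) (hV j) (hW j) hδ hN μ ν

/-- **(PR) FROM GEOMETRIC CONVERGENCE OF THE INGREDIENTS**: if `A j → A∞`, `V j → V∞`, `W j → W∞` GEOMETRICALLY in the decay
classes (`Decays (A j − A∞) (cA·θ^j) δ`, `VertexFamily (V j − V∞) N (cV·θ^j) δ`, `VertexFamily₂ (W j − W∞) N (cW·θ^j) δ`) with
uniform data, then `hessKer (A j) (V j) (W j) → hessKer A∞ V∞ W∞` geometrically with an exponentially decaying majorant:
`LimitRate.GeometricRate` with constant `lipConst(…, cA, cV, cW)` and rate `δ/4`. [folklore] -/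
theorem geometricRate_hessKer (hA : ∀ j, Decays (A j) C δ) (hAinf : Decays Ainf C δ)
    (hArate : ∀ j, Decays (A j - Ainf) (cA * θ ^ j) δ)
    (hV : ∀ j, VertexFamily (V j) N Cv δ) (hVinf : VertexFamily Vinf N Cv δ)
    (hVrate : ∀ j, VertexFamily (V j - Vinf) N (cV * θ ^ j) δ)
    (hW : ∀ j, VertexFamily₂ (W j) N Cw δ) (hWinf : VertexFamily₂ Winf N Cw δ)
    (hWrate : ∀ j, VertexFamily₂ (W j - Winf) N (cW * θ ^ j) δ) (hδ : 0 < δ) (hN : 1 ≤ N) (μ ν : Fin D) :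
    LimitRate.GeometricRate (fun j => hessKer (A j) (V j) (W j)) (hessKer Ainf Vinf Winf) μ ν
      (lipConst D (Fintype.card F) δ C C Cv Cv Cw cA cV cW) (δ / 4) θ := by
  intro j
  have h := decay510_hessKer_sub (hA j) hAinf (hArate j) (hV j) hVinf (hVrate j) (hW j) hWinf (hWrate j) hδ hN μ ν
  rw [lipConst_mul] at h
  intro x
  simpa [LimitRate.subKernel] using h x

/-- **(SW1)-SHAPE CONCLUSION — `GeomRate` OF THE (1.22)-MOMENTS WITH AN EXPLICIT CONSTANT**: under the hypotheses of
`geometricRate_hessKer`, for every channel `(μ, ν)`,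
`|secondMoment (hessKer (A j) (V j) (W j)) μ ν − secondMoment (hessKer A∞ V∞ W∞) μ ν| ≤ β′(lipConst(…, cA, cV, cW), δ/4) · θ^j`
for all `j` (`LimitRate.abs_secondMoment_sub_limit_le`), i.e. `RateCertificate.GeomRate` with `b∞` the moment of the limit kernel
and `c₀ = betaPrime510 D (lipConst …) (δ/4)`. [folklore] -/
theorem geomRate_secondMoment_hessKer (hA : ∀ j, Decays (A j) C δ) (hAinf : Decays Ainf C δ)
    (hArate : ∀ j, Decays (A j - Ainf) (cA * θ ^ j) δ)
    (hV : ∀ j, VertexFamily (V j) N Cv δ) (hVinf : VertexFamily Vinf N Cv δ)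
    (hVrate : ∀ j, VertexFamily (V j - Vinf) N (cV * θ ^ j) δ)
    (hW : ∀ j, VertexFamily₂ (W j) N Cw δ) (hWinf : VertexFamily₂ Winf N Cw δ)
    (hWrate : ∀ j, VertexFamily₂ (W j - Winf) N (cW * θ ^ j) δ) (hδ : 0 < δ) (hN : 1 ≤ N) (μ ν : Fin D) :
    RateCertificate.GeomRate (fun j => B12Beta.secondMoment (hessKer (A j) (V j) (W j)) μ ν)
      (B12Beta.secondMoment (hessKer Ainf Vinf Winf) μ ν)
      (betaPrime510 D (lipConst D (Fintype.card F) δ C C Cv Cv Cw cA cV cW) (δ / 4)) θ :=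
  fun j => LimitRate.abs_secondMoment_sub_limit_le (uniformDecay_hessKer hA hV hW hδ hN μ ν)
    (geometricRate_hessKer hA hAinf hArate hV hVinf hVrate hW hWinf hWrate hδ hN μ ν) (by linarith) (by linarith) j

/-- … and the moments CONVERGE (`0 ≤ θ < 1`). [folklore] -/
theorem tendsto_secondMoment_hessKer (hA : ∀ j, Decays (A j) C δ) (hAinf : Decays Ainf C δ)
    (hArate : ∀ j, Decays (A j - Ainf) (cA * θ ^ j) δ)
    (hV : ∀ j, VertexFamily (V j) N Cv δ) (hVinf : VertexFamily Vinf N Cv δ)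
    (hVrate : ∀ j, VertexFamily (V j - Vinf) N (cV * θ ^ j) δ)
    (hW : ∀ j, VertexFamily₂ (W j) N Cw δ) (hWinf : VertexFamily₂ Winf N Cw δ)
    (hWrate : ∀ j, VertexFamily₂ (W j - Winf) N (cW * θ ^ j) δ) (hδ : 0 < δ) (hN : 1 ≤ N) (hθ0 : 0 ≤ θ)
    (hθ1 : θ < 1) (μ ν : Fin D) :
    Tendsto (fun j => B12Beta.secondMoment (hessKer (A j) (V j) (W j)) μ ν) atTop
      (nhds (B12Beta.secondMoment (hessKer Ainf Vinf Winf) μ ν)) :=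
  (geomRate_secondMoment_hessKer hA hAinf hArate hV hVinf hVrate hW hWinf hWrate hδ hN μ ν).tendsto hθ0 hθ1

/-- **THE ROAD-A2 SOCKET BY NAME**: the moments then have the ONE-LOOP DRIFT form (`Drift.OneLoopDrift`) with slope `b∞` = the moment
of the limit kernel and defect `c₀/(1−θ)` (`RateCertificate.GeomRate.drift`). [folklore] -/
theorem oneLoopDrift_secondMoment_hessKer (hA : ∀ j, Decays (A j) C δ) (hAinf : Decays Ainf C δ)
    (hArate : ∀ j, Decays (A j - Ainf) (cA * θ ^ j) δ)
    (hV : ∀ j, VertexFamily (V j) N Cv δ) (hVinf : VertexFamily Vinf N Cv δ)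
    (hVrate : ∀ j, VertexFamily (V j - Vinf) N (cV * θ ^ j) δ)
    (hW : ∀ j, VertexFamily₂ (W j) N Cw δ) (hWinf : VertexFamily₂ Winf N Cw δ)
    (hWrate : ∀ j, VertexFamily₂ (W j - Winf) N (cW * θ ^ j) δ) (hδ : 0 < δ) (hN : 1 ≤ N) (hθ0 : 0 ≤ θ)
    (hθ1 : θ < 1) (μ ν : Fin D) :
    Drift.OneLoopDrift (B12Beta.secondMoment (hessKer Ainf Vinf Winf) μ ν)
      (betaPrime510 D (lipConst D (Fintype.card F) δ C C Cv Cv Cw cA cV cW) (δ / 4) / (1 - θ))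
      (fun j => B12Beta.secondMoment (hessKer (A j) (V j) (W j)) μ ν) :=
  (geomRate_secondMoment_hessKer hA hAinf hArate hV hVinf hVrate hW hWinf hWrate hδ hN μ ν).drift hθ0 hθ1

end Rate

/-! ## §5 Units invariance: fibrewise rescaling of the ingredients -/

omit [Fintype F] in
/-- FIBREWISE RESCALING of a kernel: `(u K v)(x, y)_{ab} := u_a · K(x, y)_{ab} · v_b` (diagonal, constant in the sites). [folklore] -/
def scaleK (u v : F → ℝ) (K : MKer D F) : MKer D F := fun x y a b => u a * K x y a b * v b

omit [Fintype F] in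
/-- Entries of the rescaled kernel. [folklore] -/
@[simp] theorem scaleK_apply (u v : F → ℝ) (K : MKer D F) (x y : (Fin D → ℤ)) (a b : F) :
    scaleK u v K x y a b = u a * K x y a b * v b := rfl

/-- `(uAv)∘(v′Kw) = u(A∘K)w` when `v·v′ = 1` (the inner units cancel). [folklore] -/
theorem comp_scaleK (u v v' w : F → ℝ) (hv : ∀ f, v f * v' f = 1) (A K : MKer D F) :
    comp (scaleK u v A) (scaleK v' w K) = scaleK u w (comp A K) := by
  funext x z a b
  simp only [ExpKernelCalculus.comp, scaleK]
  have hy : ∀ y : (Fin D → ℤ), ∑ f, u a * A x y a f * v f * (v' f * K y z f b * w b) = u a * (∑ f, A x y a f * K y z f b) * w b := by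
    intro y
    rw [Finset.mul_sum, Finset.sum_mul]
    refine Finset.sum_congr rfl fun f _ => ?_
    calc u a * A x y a f * v f * (v' f * K y z f b * w b) = u a * (A x y a f * K y z f b) * w b * (v f * v' f) := by ring
      _ = u a * (A x y a f * K y z f b) * w b := by rw [hv f, mul_one]
  simp_rw [hy]
  rw [tsum_mul_right, tsum_mul_left]

/-- `tr (uKv) = tr K` when `u·v = 1`. [folklore] -/
theorem tr_scaleK (u v : F → ℝ) (huv : ∀ a, u a * v a = 1) (K : MKer D F) : tr (scaleK u v K) = tr K := by
  simp only [ExpKernelCalculus.tr, scaleK]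
  refine tsum_congr fun x => Finset.sum_congr rfl fun a _ => ?_
  calc u a * K x x a a * v a = K x x a a * (u a * v a) := by ring
    _ = K x x a a := by rw [huv a, mul_one]

/-- The tadpole is invariant under `A ↦ uAu`, `W₂ ↦ u′W₂u′` with `u·u′ = 1`. [folklore] -/
theorem tadpole_scaleK (u u' : F → ℝ) (h : ∀ a, u a * u' a = 1) (A W₂ : MKer D F) :
    tadpole (scaleK u u A) (scaleK u' u' W₂) = tadpole A W₂ := by
  unfold ExpKernelCalculus.tadpole
  rw [comp_scaleK u u u' u' h, tr_scaleK u u' h]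

/-- The bubble is invariant under `A ↦ uAu`, `V ↦ u′Vu′`, `W ↦ u′Wu′` with `u·u′ = 1`. [folklore] -/
theorem bubble_scaleK (u u' : F → ℝ) (h : ∀ a, u a * u' a = 1) (A V W : MKer D F) :
    bubble (scaleK u u A) (scaleK u' u' V) (scaleK u' u' W) = bubble A V W := by
  have h' : ∀ a, u' a * u a = 1 := fun a => by rw [mul_comm]; exact h a
  unfold ExpKernelCalculus.bubble
  rw [comp_scaleK u u u' u' h A V, comp_scaleK u u u' u' h A W, comp_scaleK u u' u u' h' (comp A V) (comp A W),
    tr_scaleK u u' h]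

/-- **UNITS INVARIANCE OF THE RESOLVENT HESSIAN KERNEL**: `hessKer (uAu) (u′Vu′) (u′Wu′) = hessKer A V W` for `u·u′ = 1`. [folklore] -/
theorem hessKer_scaleK (u u' : F → ℝ) (h : ∀ a, u a * u' a = 1) (A : MKer D F) (V : Fin D → (Fin D → ℤ) → MKer D F)
    (W : Fin D → (Fin D → ℤ) → Fin D → (Fin D → ℤ) → MKer D F) :
    hessKer (scaleK u u A) (fun μ y => scaleK u' u' (V μ y)) (fun μ y ν y' => scaleK u' u' (W μ y ν y')) = hessKer A V W := by
  funext μ ν z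
  simp only [hessKer, tadpole_scaleK u u' h, bubble_scaleK u u' h]

omit [Fintype F] in
/-- Rescaling transports `Decays`: constant `U·C·U′` for `|u| ≤ U`, `|v| ≤ U′`. [folklore] -/
theorem decays_scaleK {u v : F → ℝ} {U U' : ℝ} (hu : ∀ a, |u a| ≤ U) (hv : ∀ b, |v b| ≤ U') {K : MKer D F} {C δ : ℝ}
    (hK : Decays K C δ) : Decays (scaleK u v K) (U * C * U') δ := by
  intro x y a b
  simp only [scaleK_apply, abs_mul]
  have hC := hK.nonneg a
  have hU : 0 ≤ U := (abs_nonneg _).trans (hu a)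
  calc |u a| * |K x y a b| * |v b| ≤ U * (C * Real.exp (-δ * l1 (x - y))) * U' :=
        mul_le_mul (mul_le_mul (hu a) (hK x y a b) (abs_nonneg _) hU) (hv b) (abs_nonneg _)
          (mul_nonneg hU (mul_nonneg hC (Real.exp_pos _).le))
    _ = U * C * U' * Real.exp (-δ * l1 (x - y)) := by ring

omit [Fintype F] in
/-- Rescaling transports `BiLoc`: constant `U·C·U′` for `|u| ≤ U`, `|v| ≤ U′`. [folklore] -/
theorem biLoc_scaleK {u v : F → ℝ} {U U' : ℝ} (hu : ∀ a, |u a| ≤ U) (hv : ∀ b, |v b| ≤ U') {K : MKer D F} {p q : (Fin D → ℤ)}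
    {C δ : ℝ} (hK : BiLoc K p q C δ) : BiLoc (scaleK u v K) p q (U * C * U') δ := by
  intro x y a b
  simp only [scaleK_apply, abs_mul]
  have hC := hK.nonneg a
  have hU : 0 ≤ U := (abs_nonneg _).trans (hu a)
  calc |u a| * |K x y a b| * |v b| ≤ U * (C * Real.exp (-δ * (l1 (x - p) + l1 (y - q)))) * U' :=
        mul_le_mul (mul_le_mul (hu a) (hK x y a b) (abs_nonneg _) hU) (hv b) (abs_nonneg _)
          (mul_nonneg hU (mul_nonneg hC (Real.exp_pos _).le))
    _ = U * C * U' * Real.exp (-δ * (l1 (x - p) + l1 (y - q))) := by ring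

/-! ## §6 (v1.1) The chain-rule vertex `vertexOfK K N S` is Lipschitz in `(K, S)`

`OneStepKernelFamily.TstepOf Lc j J = hessKer K (vertexOfK K Lc J.S) J.W` with `K = KInvStep Lc j`: the first-order slot of the
step kernel is itself BUILT from the resolvent `K` and a local stencil table `S` (`vertexOfK K N S μ y = Σ_{κ′} wsum (colH K N μ y κ′)
(S κ′)`, `OneStepKernelFamily` §3).  To state (CONV-C) on the PRIMITIVES `(K_j, S_j, W_j)` rather than on `V_j = vertexOfK K_j N S_j`,
§4's hypothesis `VertexFamily (V j − V∞) N (cV θ^j) δ` must follow from the convergence of `K_j` and `S_j`; this is one more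
telescoping, through the weighted superposition `OneStepResolventKernel.wsum` (an absolutely convergent lattice sum):
`wsum_sub_wsum`, `biLoc_wsum_sub_wsum`, `colH_sub`, **`vertexFamily_vertexOfK_sub`** (explicit constant `(d+1)·(εK·Cs + C′·εS)·Zl(δ/2)`, rate `δ/2`),
and the rate form **`vertexFamily_vertexOfK_rate`** (constant · `θ^j`).  [folklore]; nothing here is specific to Bałaban's `K`. -/

section VertexLip

open Literature.MathematicalPhysics.QuantumFieldTheory.Balaban1983to89.Beta.OneStepResolventKernel (Fib wsum LocStencil
  biLoc_wsum summable_wsumTerm biLoc_finset_sum bound_mono)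
open Literature.MathematicalPhysics.QuantumFieldTheory.Balaban1983to89.Beta.OneStepKernelFamily (colH vertexOfK abs_colH_le)

variable {d : ℕ}

omit [Fintype F] in
/-- **TELESCOPING OF WEIGHTED SUPERPOSITIONS**: `wsum w K − wsum w′ K′ = wsum (w − w′) K + wsum w′ (K − K′)` for weights decaying
from `p` and self-localised families (all four series absolutely convergent). [folklore] -/
theorem wsum_sub_wsum {w w' : (Fin D → ℤ) → ℝ} {K K' : (Fin D → ℤ) → MKer D F} {C C' Ck Ck' δ : ℝ} {p : Fin D → ℤ}
    (hw : ∀ u, |w u| ≤ C * Real.exp (-δ * l1 (u - p))) (hw' : ∀ u, |w' u| ≤ C' * Real.exp (-δ * l1 (u - p)))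
    (hK : ∀ u, BiLoc (K u) u u Ck δ) (hK' : ∀ u, BiLoc (K' u) u u Ck' δ) (hδ : 0 < δ) (hC : 0 ≤ C) (hC' : 0 ≤ C') :
    wsum w K - wsum w' K' = wsum (w - w') K + wsum w' (K - K') := by
  funext x z a b
  have hs := summable_wsumTerm hw hK hδ hC x z a b
  have hs' := summable_wsumTerm hw' hK' hδ hC' x z a b
  have hsK := summable_wsumTerm hw' hK hδ hC' x z a b
  simp only [Pi.sub_apply, Pi.add_apply, wsum]
  have h1 : (fun u => (w u - w' u) * K u x z a b) = fun u => w u * K u x z a b - w' u * K u x z a b :=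
    funext fun u => by ring
  have h2 : (fun u => w' u * (K u x z a b - K' u x z a b)) = fun u => w' u * K u x z a b - w' u * K' u x z a b :=
    funext fun u => by ring
  rw [h1, h2, hs.tsum_sub hsK, hsK.tsum_sub hs']
  ring

omit [Fintype F] in
/-- **SMALLNESS OF THE DIFFERENCE OF WEIGHTED SUPERPOSITIONS**: with deviations `εw` (weights) and `εK` (family),
`wsum w K − wsum w′ K′` is bi-localised at `(p, p)` with constant `(εw·Ck + C′·εK)·Zl(δ/2)`, rate `δ/2`. [folklore] -/
theorem biLoc_wsum_sub_wsum {w w' : (Fin D → ℤ) → ℝ} {K K' : (Fin D → ℤ) → MKer D F} {C C' Ck Ck' εw εK δ : ℝ}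
    {p : Fin D → ℤ} (hw : ∀ u, |w u| ≤ C * Real.exp (-δ * l1 (u - p))) (hw' : ∀ u, |w' u| ≤ C' * Real.exp (-δ * l1 (u - p)))
    (hww : ∀ u, |w u - w' u| ≤ εw * Real.exp (-δ * l1 (u - p))) (hK : ∀ u, BiLoc (K u) u u Ck δ)
    (hK' : ∀ u, BiLoc (K' u) u u Ck' δ) (hKK : ∀ u, BiLoc (K u - K' u) u u εK δ) (hδ : 0 < δ) (hC : 0 ≤ C) (hC' : 0 ≤ C')
    (hεw : 0 ≤ εw) : BiLoc (wsum w K - wsum w' K') p p ((εw * Ck + C' * εK) * Zl D (δ / 2)) (δ / 2) := by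
  rw [wsum_sub_wsum hw hw' hK hK' hδ hC hC']
  have h1 : BiLoc (wsum (w - w') K) p p (εw * Ck * Zl D (δ / 2)) (δ / 2) := biLoc_wsum (fun u => hww u) hK hδ hεw
  have h2 : BiLoc (wsum w' (K - K')) p p (C' * εK * Zl D (δ / 2)) (δ / 2) := biLoc_wsum hw' (fun u => hKK u) hδ hC'
  have h := biLoc_add h1 h2
  intro x z a' b'
  refine (h x z a' b').trans (le_of_eq ?_)
  ring

/-- The `ℋ`-column is linear in the kernel: `colH (K − K′) = colH K − colH K′` (entrywise). [folklore] -/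
theorem colH_sub (K K' : MKer (d + 1) (Fib d)) (N : ℕ) (μ : Fin (d + 1)) (y : Fin (d + 1) → ℤ) (κ' : Fin (d + 1))
    (u : Fin (d + 1) → ℤ) : colH (K - K') N μ y κ' u = colH K N μ y κ' u - colH K' N μ y κ' u := by
  simp [colH]

/-- **THE CHAIN-RULE VERTEX IS LIPSCHITZ IN `(K, S)`**: for decaying `K, K′` (constants `C, C′`, difference `εK`, rate `δK`) and local
stencil tables `S, S′` (constants `Cs, Cs′`, difference `εS`, rate `δ ≤ δK`):
`VertexFamily (vertexOfK K N S − vertexOfK K′ N S′) N ((d+1)·((εK·Cs + C′·εS)·Zl(δ/2))) (δ/2)`. [folklore] -/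
theorem vertexFamily_vertexOfK_sub {K K' : MKer (d + 1) (Fib d)} {C C' εK δK : ℝ} (hK : Decays K C δK) (hK' : Decays K' C' δK)
    (hKK : Decays (K - K') εK δK) {S S' : Fin (d + 1) → (Fin (d + 1) → ℤ) → MKer (d + 1) (Fib d)} {Cs Cs' εS δ : ℝ}
    (hS : LocStencil S Cs δ) (hS' : LocStencil S' Cs' δ) (hSS : LocStencil (S - S') εS δ) (hδ : 0 < δ) (hδK : δ ≤ δK)
    (N : ℕ) :
    VertexFamily (vertexOfK K N S - vertexOfK K' N S') N ((d + 1 : ℕ) * ((εK * Cs + C' * εS) * Zl (d + 1) (δ / 2))) (δ / 2) := by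
  intro μ y
  have hC : 0 ≤ C := hK.nonneg (Sum.inl 0)
  have hC' : 0 ≤ C' := hK'.nonneg (Sum.inl 0)
  have hεK : 0 ≤ εK := hKK.nonneg (Sum.inl 0)
  have hw : ∀ κ' u, |colH K N μ y κ' u| ≤ C * Real.exp (-δ * l1 (u - (N : ℤ) • y)) := fun κ' u =>
    bound_mono (abs_colH_le (N := N) hK μ y κ' u) hC le_rfl hδK (l1_nonneg _)
  have hw' : ∀ κ' u, |colH K' N μ y κ' u| ≤ C' * Real.exp (-δ * l1 (u - (N : ℤ) • y)) := fun κ' u =>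
    bound_mono (abs_colH_le (N := N) hK' μ y κ' u) hC' le_rfl hδK (l1_nonneg _)
  have hww : ∀ κ' u, |colH K N μ y κ' u - colH K' N μ y κ' u| ≤ εK * Real.exp (-δ * l1 (u - (N : ℤ) • y)) :=
    fun κ' u => by
      rw [← colH_sub]
      exact bound_mono (abs_colH_le (N := N) hKK μ y κ' u) hεK le_rfl hδK (l1_nonneg _)
  have hterm : ∀ κ' : Fin (d + 1), BiLoc (wsum (colH K N μ y κ') (S κ') - wsum (colH K' N μ y κ') (S' κ'))
      ((N : ℤ) • y) ((N : ℤ) • y) ((εK * Cs + C' * εS) * Zl (d + 1) (δ / 2)) (δ / 2) := fun κ' =>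
    biLoc_wsum_sub_wsum (hw κ') (hw' κ') (hww κ') (fun u => hS κ' u) (fun u => hS' κ' u) (fun u => hSS κ' u) hδ hC hC' hεK
  have hsum := biLoc_finset_sum (Finset.univ : Finset (Fin (d + 1))) (fun κ' _ => hterm κ')
  simp only [Finset.sum_const, Finset.card_univ, Fintype.card_fin, nsmul_eq_mul] at hsum
  intro x z a b
  have h := hsum x z a b
  simpa only [vertexOfK, Pi.sub_apply, Finset.sum_sub_distrib] using h

/-- **RATE FORM**: if `K_j → K∞` geometrically in `Decays` (`εK = cK·θ^j`) and `S_j → S∞` geometrically in `LocStencil` (`εS = cS·θ^j`)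
with uniform data, then `vertexOfK K_j N S_j → vertexOfK K∞ N S∞` geometrically as a `VertexFamily` (constant
`(d+1)·((cK·Cs + C·cS)·Zl(δ/2))`, rate `δ/2`) — the shape of §4's hypothesis `hVrate`. [folklore] -/
theorem vertexFamily_vertexOfK_rate {K : ℕ → MKer (d + 1) (Fib d)} {Kinf : MKer (d + 1) (Fib d)}
    {S : ℕ → Fin (d + 1) → (Fin (d + 1) → ℤ) → MKer (d + 1) (Fib d)} {Sinf : Fin (d + 1) → (Fin (d + 1) → ℤ) → MKer (d + 1) (Fib d)}
    {C cK δK Cs cS δ θ : ℝ} (hK : ∀ j, Decays (K j) C δK) (hKinf : Decays Kinf C δK)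
    (hKrate : ∀ j, Decays (K j - Kinf) (cK * θ ^ j) δK) (hS : ∀ j, LocStencil (S j) Cs δ) (hSinf : LocStencil Sinf Cs δ)
    (hSrate : ∀ j, LocStencil (S j - Sinf) (cS * θ ^ j) δ) (hδ : 0 < δ) (hδK : δ ≤ δK) (N : ℕ) (j : ℕ) :
    VertexFamily (vertexOfK (K j) N (S j) - vertexOfK Kinf N Sinf) N
      ((d + 1 : ℕ) * ((cK * Cs + C * cS) * Zl (d + 1) (δ / 2)) * θ ^ j) (δ / 2) := by
  have h := vertexFamily_vertexOfK_sub (hK j) hKinf (hKrate j) (hS j) hSinf (hSrate j) hδ hδK N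
  intro μ y x z a b
  refine (h μ y x z a b).trans (le_of_eq ?_)
  push_cast
  ring

/-- The chain-rule vertex of uniform data is a uniform `VertexFamily` (explicit constant, = `OneStepKernelFamily.vertexFamily_vertexOfK`
restated for families) — the shape of §4's hypothesis `hV`. [folklore] -/
theorem vertexFamily_vertexOfK_uniform {K : ℕ → MKer (d + 1) (Fib d)} {C δK : ℝ} (hK : ∀ j, Decays (K j) C δK)
    {S : ℕ → Fin (d + 1) → (Fin (d + 1) → ℤ) → MKer (d + 1) (Fib d)} {Cs δ : ℝ} (hS : ∀ j, LocStencil (S j) Cs δ)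
    (hδ : 0 < δ) (hδK : δ ≤ δK) (N : ℕ) (j : ℕ) :
    VertexFamily (vertexOfK (K j) N (S j)) N ((d + 1 : ℕ) * (C * Cs * Zl (d + 1) (δ / 2))) (δ / 2) :=
  OneStepKernelFamily.vertexFamily_vertexOfK (N := N) (hK j) ((hK j).nonneg (Sum.inl 0)) (hS j) hδ hδK

end VertexLip

end

end Literature.MathematicalPhysics.QuantumFieldTheory.Balaban1983to89.Beta.HessKerRate
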